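import Mathlib.Tactic
import HarnessLib

/-!
# K6 — THE DISCRIMINANT MASTER FORMULA behind the drop-point datum: algebraic core and the lineage inequality

[OURS · L1 W4.5a · res-L1-w45a-lead-1 g14 · kernel brick K6 for crux `FInjectiveMacaulayfication` stmt-ResolutionOfSingularities-15315; companion of
`Cruxes/FInjectiveMacaulayfication/Lines/T-disc.md`; supports the crux, proves nothing of it; OURS counted 0; AI-written (AI review is weaker than expert review).]

WHY. At a rank-one drop point `x_k` (Weierstrass letter `x`) reached by a chain of blow-ups from a FULL triple point whose tangent cone contains `x³`,
the Weierstrass-prepared equation is `W·R` with `W = x² + Bx + C` (the two small roots) and `R = μx + ρ` (ρ a unit), and the level-2 datum is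
`a″ = C − B²/4 = −disc(W)/4`. The memo `T-disc.md` shows `−4a″ · Res(W,R)² = m⁻⁶ · (Disc_x f)∘(chain substitution)`, reducing every drop-point datum of every
chain to the Newton polyhedron of ONE series `Disc_x f` at the original point. This file puts the two ring identities and the final inequality in the kernel:
* ★ `cubicDisc_quadratic_mul_linear` — MULTIPLICATIVITY: for `W = x² + Bx + C`, `R = μx + ρ`, the cubic `W·R = μx³ + (ρ + μB)x² + (ρB + μC)x + ρC` has
  discriminant `(B² − 4C) · (μ²C − μρB + ρ²)²` (= `disc W · disc R · Res(W,R)²` with `disc R = 1`);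
* ★ `cubicDisc_strictTransform` — SUBSTITUTION LAW: `m⁶ · disc(a, b', c', d') = disc(a, b'm, c'm², d'm³)` (weighted homogeneity of degree 6), i.e. for the
  strict transform `m⁻³·f(x′m)` one has `disc = m⁻⁶ · (Disc f)∘sub` (the discriminant written out: `b²c² − 4ac³ − 4b³d − 27a²d² + 18abcd`);
* ★★ `lineage_ordN_le_eight` — THE LINEAGE INEQUALITY: if the minimal `s`-level `α = j + k(e − 6)` of the discriminant is attained by a monomial of
  transversal degree `e` (so `ord N ≤ e`), `ω = α + ord N`, and the log-canonical budget `ω ≤ 8 + 2k` holds, then `ord N ≤ 8` — whence no wild point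
  (`ord N ≥ p`) on a pure lineage for any prime `p ≥ 11`, at any depth `k`.
No named fact; `ring` and linear arithmetic.
-/

-- single-problem summit: the doubled namespace component is forced
set_option linter.dupNamespace false

namespace Summit.ResolutionOfSingularities.ResolutionOfSingularities.Theorems.FInjectiveMacaulayfication.FullLineageDisc

section Disc

variable {A : Type} [CommRing A]

/-- ★ MULTIPLICATIVITY (`disc(W·R) = disc W · disc R · Res(W,R)²`, `disc R = 1` for linear `R`): the product of the monic quadratic
`W = x² + Bx + C` and the linear `R = μx + ρ` is `a x³ + b x² + c x + d` with `a = μ`, `b = ρ + μB`, `c = ρB + μC`, `d = ρC`, and its cubic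
discriminant `b²c² − 4ac³ − 4b³d − 27a²d² + 18abcd` equals `(B² − 4C)·(μ²C − μρB + ρ²)²`, where `B² − 4C = disc W = −4a″` and
`μ²C − μρB + ρ² = R(x₊)R(x₋) = Res(W,R)`. [OURS; classical] -/
theorem cubicDisc_quadratic_mul_linear (B C μ ρ : A) :
    (ρ + μ * B) ^ 2 * (ρ * B + μ * C) ^ 2 - 4 * μ * (ρ * B + μ * C) ^ 3 - 4 * (ρ + μ * B) ^ 3 * (ρ * C)
      - 27 * μ ^ 2 * (ρ * C) ^ 2 + 18 * μ * (ρ + μ * B) * (ρ * B + μ * C) * (ρ * C)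
      = (B ^ 2 - 4 * C) * (μ ^ 2 * C - μ * ρ * B + ρ ^ 2) ^ 2 := by
  ring

/-- ★ SUBSTITUTION LAW (weighted homogeneity of degree 6 in `(b : 1, c : 2, d : 3)`): if `b'·m = b`, `c'·m² = c`, `d'·m³ = d` — the coefficients of
the strict transform `m⁻³·f(x′m)` of `f = a x³ + b x² + c x + d` — then `m⁶ · disc(a, b', c', d') = disc(a, b, c, d)`; i.e. at the drop point
`disc_x′(strict transform) = m⁻⁶ · (Disc_x f)∘(chain substitution)`. [OURS; classical] -/
theorem cubicDisc_strictTransform (a b c d b' c' d' m : A) (hb : b' * m = b) (hc : c' * m ^ 2 = c) (hd : d' * m ^ 3 = d) :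
    m ^ 6 * (b' ^ 2 * c' ^ 2 - 4 * a * c' ^ 3 - 4 * b' ^ 3 * d' - 27 * a ^ 2 * d' ^ 2 + 18 * a * b' * c' * d')
      = b ^ 2 * c ^ 2 - 4 * a * c ^ 3 - 4 * b ^ 3 * d - 27 * a ^ 2 * d ^ 2 + 18 * a * b * c * d := by
  subst hb; subst hc; subst hd
  ring

end Disc

section Lineage

/-- ★★ THE LINEAGE INEQUALITY. On a pure lineage of depth `k`, a monomial `y₁^j·Y^γ` (`|γ| = e`) of the discriminant sits at `s`-level
`j + k·e − 6k` (the master formula); if the MINIMAL level `α` is attained by such a monomial then `ord N ≤ e`; with `ω = α + ord N` and the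
log-canonical budget `ω ≤ 8 + 2k` this forces `ord N ≤ 8`. (Case `e ≤ 8`: `ord N ≤ e`; case `e ≥ 9`: `α ≥ 3k`, so `ord N ≤ 8 − k`.) [OURS] -/
theorem lineage_ordN_le_eight (k j e α ω ordN : ℕ)
    (hα : α + 6 * k = j + k * e)      -- α = j + k(e − 6), written without truncated subtraction
    (hN : ordN ≤ e)                   -- ord N ≤ ord N̄ = e
    (hω : ω = α + ordN)               -- ω = |M| + ord N
    (hbudget : ω ≤ 8 + 2 * k) :       -- lc budget at x_k (F-pure ⇒ lc, transversal chain: defect d_k = k)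
    ordN ≤ 8 := by
  by_cases he : e ≤ 8
  · omega
  · -- e ≥ 9: k·e ≥ 9k, hence α ≥ 3k + j and ordN ≤ 8 + 2k − α ≤ 8 − k
    have h9 : 9 * k ≤ k * e := by nlinarith
    omega

/-- Corollary: NO WILD POINT ON A PURE LINEAGE for `p ≥ 9` (in particular `p ≥ 11`): under the hypotheses of `lineage_ordN_le_eight`,
`ord N < p`. [OURS] -/
theorem lineage_not_wild (p k j e α ω ordN : ℕ) (hp : 9 ≤ p)
    (hα : α + 6 * k = j + k * e) (hN : ordN ≤ e) (hω : ω = α + ordN) (hbudget : ω ≤ 8 + 2 * k) :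
    ordN < p :=
  lt_of_le_of_lt (lineage_ordN_le_eight k j e α ω ordN hα hN hω hbudget) (by omega)

/-- The multi-letter form of the order bound used for point chains: if every exceptional letter `E` through the drop point has
`λ_E(γ) ≥ c_E · e` on transversal degree `e ≥ p`, then the order `Σ_E (λ_E − 6c_E) + e ≥ (p − 6)·Σc + p` exceeds the budget `8 + 2Σc`
as soon as `p ≥ 9` — so initial monomials of the datum have transversal degree `0`. Stated for the aggregate `C = Σ_E c_E ≥ 1`. [OURS] -/
theorem transversal_degree_zero_of_budget (p C e L : ℕ) (hp : 9 ≤ p) (hC : 1 ≤ C) (he : p ≤ e)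
    (hL : C * e ≤ L)                          -- Σ_E λ_E(γ) ≥ (Σ_E c_E)·e
    (hbudget : L + e ≤ 8 + 2 * C + 6 * C) :   -- order = (L − 6C) + e ≤ 8 + 2C
    False := by
  have h1 : C * p ≤ C * e := Nat.mul_le_mul_left C he
  have h2 : 9 * C ≤ C * p := by nlinarith
  omega

end Lineage

end Summit.ResolutionOfSingularities.ResolutionOfSingularities.Theorems.FInjectiveMacaulayfication.FullLineageDisc
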